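import Summits.Ventures.AbcSig.Conjectures.LRRed

/-!
# Venture AbcSig — LR-RED split into its DERIVED part ([BillereyMenares2018, Thm 2]) and its residual OPEN part (the SM cells)

HONEST FRAMING. Bookkeeping companion of `Conjectures/LRRed.lean` (the typed law LR-RED, RULING W1). It adds ONE cited
hypothesis-def — `NewformModel.BM18Thm2Bridge`, the class-level consequence of [BillereyMenares2018, Thm 2] (+ Carayol's remark)
in the LR-RED scope — and PROVES that, modulo that named fact, the conjecture `LRRedModel` is EQUIVALENT to its restriction
`LRRedSM` to the strongly-modular cells. Nothing is proved about LR-RED itself; `LRRedSM` is exactly as open as `LRRedModel`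
(its «⇐» is the IDENTIFIED SM-sufficiency clause; its «⇒» is the lead's DERIVED local Steinberg-at-`M` reading, not pinned to a
printed statement and therefore NOT taken as a named fact here). No claim about any Diophantine equation or any summit.

WHY CLASS-LEVEL. The registration (HOME/lead/PREDICTIONS-ODDCHAR2-lead-g8.md `1311f7c7b14a5762`) and `Conjectures/LRRed.lean` quantify
over the Galois CLASS `[ε]` («∃ λ ∣ l», integer norms): `SMmodel M C d l` says SOME character of exact order `d` mod `C` over a
field of characteristic `l` gives a strongly modular `ρ̄ = χ ⊕ χ⁻¹χ_l`. [BillereyMenares2018, Thm 2] is a statement about ONE `ρ̄`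
that is NOT strongly modular; applied to every member of a class none of whose members is strongly modular (`¬ SMmodel`), it gives
exactly `BM18Thm2Bridge` below (for a member that IS strongly modular, "arises from type `(NM, 2, 𝟙)`" holds trivially through
old forms, and the NEWFORM question at level `C²M` is the open SM branch — which is why Theorem 2 assumes `ρ` not strongly modular).
-/

namespace Summit.Ventures.AbcSig.Conjectures

open Summit.Ventures.AbcSig

/-- **NAMED FACT [BillereyMenares2018, Thm 2] (with Carayol's remark, p. 3), specialised to the LR-RED scope at the class level —
a HYPOTHESIS-DEF, CITED, never proved here, never an axiom.** Printed (Trans. AMS 370 (2018), p. 3, verbatim in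
HOME/lit/QB-BILLEREY-MENARES-PINS-g8.md §1): "In the same notation and under the same assumptions as in Theorem 1, assume moreover
that `ρ` is not strongly modular. Let `M` be a prime number not dividing `Nl`. Then `ρ` arises from a modular form of type
`(NM, k, ε)` if and only if `M ≡ 1 (mod l)` if `(N, k) = (1, 2)` (Mazur); `η(M)M^k = 1` if `(N, k) ≠ (1, 2)`." + "due to the
results of Carayol already mentioned, the modular form over `𝔽̄_l` in Theorem 2 can be taken to be the reduction of a newform of
level `NM`". SPECIALISATION (hypotheses (H1)–(H4) of Theorem 1 as in `NewformModel.BM18Bridge`, lit/BM18-THM1-HYPOTHESES-g9.md §3;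
here `N = C²`, `k = 2`, so `(N, k) ≠ (1, 2)`; `M ∤ Nl` ⟸ `M` prime, `M ≠ C`, `M ≠ l`; `η = ε⁻²`, so `η(M)M² = 1` reads
`M² = ε̄(M)²`): if NO character of exact order `d` mod `C` over a field of characteristic `l` gives a strongly modular `ρ̄`
(`¬ SMmodel M C d l`), then — applying Theorem 2 to each member `ρ̄ = χ ⊕ χ⁻¹χ_l` of the class, for which an eigenform of type
`(C²M, 2, 𝟙)` giving `ρ̄` is automatically new of exact level `C²M` (`N(ρ̄) = C²` divides its level, which is not `C²`) —
a newform of weight 2, trivial character, exact level `C²·M` Eisenstein-congruent with the class exists iff some member has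
`χ(M)² = M²`: `EisCell M (C^2 * M') C d l ↔ EtaLevelRaiseCond C d M' l`. [cite: BillereyMenares2018, Thm 2].
MEANINGFUL ONLY FOR THE INTENDED MODEL. -/
def _root_.Summit.Ventures.AbcSig.NewformModel.BM18Thm2Bridge (M : NewformModel) : Prop :=
  ∀ C d M' l : ℕ, C.Prime → C ≠ 2 → 3 ≤ d → d ∣ C - 1 → l.Prime → 5 ≤ l → l ≠ C → ¬ l ∣ d →
    M'.Prime → M' ≠ C → M' ≠ l → ¬ SMmodel M C d l →
    (EisCell M (C ^ 2 * M') C d l ↔ EtaLevelRaiseCond C d M' l)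

/-- **`LRRedSM` — the law LR-RED restricted to the STRONGLY MODULAR cells (its residual open content) — NOT A THEOREM.**
For every cell in scope whose class is strongly modular at `C²` (`SMmodel`): a newform of weight 2, trivial character, exact
level `C²·M` Eisenstein-congruent with the class exists iff `η(M)·M² ≡ 1 (mod λ)` or `η(M) ≡ 1 (mod λ)` for some `λ ∣ l`
(field level: some member has `χ(M)² = M²`, resp. `χ(M)² = 1`). «⇐» is the IDENTIFIED SM-sufficiency clause (observed only:
tests 1–3 of HOME/STRUCTURE.md §9 T7); «⇒» is the lead's DERIVED local reading (Steinberg at `M`), not a cited named fact here.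
Under `NewformModel.BM18Thm2Bridge`, `LRRedModel M ↔ LRRedSM M` (`lrredModel_iff_lrredSM`). -/
@[conjecture] def LRRedSM (M : NewformModel) : Prop :=
  ∀ C d M' l : ℕ, LRRedScope C d M' l → SMmodel M C d l →
    (EisCell M (C ^ 2 * M') C d l ↔ EtaLevelRaiseCond C d M' l ∨ EtaTrivialCond C d M' l)

/-- `LRRedModel` implies its restriction to the SM cells (no named fact needed). PROVED bookkeeping. -/
theorem lrredSM_of_lrredModel (M : NewformModel) (h : LRRedModel M) : LRRedSM M := by
  intro C d M' l hs hSM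
  rw [h C d M' l hs]
  constructor
  · rintro (h1 | ⟨h2, -⟩)
    · exact Or.inl h1
    · exact Or.inr h2
  · rintro (h1 | h2)
    · exact Or.inl h1
    · exact Or.inr ⟨h2, hSM⟩

/-- Modulo [BillereyMenares2018, Thm 2] (`BM18Thm2Bridge`), the SM-cell statement `LRRedSM` gives back the whole law
`LRRedModel`: off SM the law IS Theorem 2. PROVED bookkeeping — it records in the kernel that the open content of LR-RED is
confined to the strongly-modular cells. -/
theorem lrredModel_of_bm18Thm2_of_lrredSM (M : NewformModel) (h2 : M.BM18Thm2Bridge) (hSM : LRRedSM M) :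
    LRRedModel M := by
  intro C d M' l hs
  obtain ⟨hC, hC2, hd, hdC, hM, hMC, hl, h5, hndvd⟩ := hs
  by_cases hS : SMmodel M C d l
  · rw [hSM C d M' l ⟨hC, hC2, hd, hdC, hM, hMC, hl, h5, hndvd⟩ hS]
    constructor
    · rintro (h1 | h2)
      · exact Or.inl h1
      · exact Or.inr ⟨h2, hS⟩
    · rintro (h1 | ⟨h2, -⟩)
      · exact Or.inl h1
      · exact Or.inr h2
  · have hlC : l ≠ C := by
      rintro rfl
      exact hndvd (dvd_mul_of_dvd_left (dvd_mul_right l M') d)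
    have hld : ¬ l ∣ d := fun h => hndvd (dvd_mul_of_dvd_right h (C * M'))
    have hMl : M' ≠ l := by
      rintro rfl
      exact hndvd (dvd_mul_of_dvd_left (dvd_mul_left M' C) d)
    rw [h2 C d M' l hC hC2 hd hdC hl h5 hlC hld hM hMC hMl hS]
    constructor
    · exact Or.inl
    · rintro (h1 | ⟨-, h⟩)
      · exact h1
      · exact absurd h hS

/-- **The split.** Modulo [BillereyMenares2018, Thm 2]: `LRRedModel M ↔ LRRedSM M`. PROVED bookkeeping. -/
theorem lrredModel_iff_lrredSM (M : NewformModel) (h2 : M.BM18Thm2Bridge) : LRRedModel M ↔ LRRedSM M :=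
  ⟨lrredSM_of_lrredModel M, lrredModel_of_bm18Thm2_of_lrredSM M h2⟩

end Summit.Ventures.AbcSig.Conjectures
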